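import Literature.Probability.Percolation.WernerPivotalEstimatesProofs
import Literature.Probability.Percolation.SiteRussoInequality
import Literature.Probability.Percolation.ArmEventsStructure
import HarnessLib

/-!
# Werner's Lecture 6, §5: the differential inequality for the four-arm event and its integration (proofs only)

Topic `Literature/Probability/Percolation`; family `crit-perc`, statement **crit-perc.S16**
(`Literature.Probability.Percolation.triTheta_exponent`, `θ(p) = (p - 1/2)^{5/36 + o(1)}`;
Smirnov–Werner 2001, Thm. 1 (i) of arXiv:math/0109120, via Kesten 1987). Sibling PROOF file of
`WernerPivotalEstimates.lean` / `WernerPivotalEstimatesProofs.lean` (no new definition, no new named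
fact). W. Werner, *Lectures on two-dimensional critical percolation* (PCMI 16, 2009), Lecture 6,
§5, "Using differential inequalities for the four arm event", derives Lemma 6.3
(`π̂_{p'}(n) ≍ π̂_{1/2}(n)` below `L`, the tree's named fact `Werner2009_lemma63`) in three moves:

1. Russo's inequality for the non-monotone event `Π̂_n`:
   `|d/dp π̂_p(n)| ≤ Σ_x P_p(x is pivotal for Π̂_n)` (first display);
2. the four-arm pivotal estimate `Σ_x P_p(x pivotal for Π̂_n) ≤ … ≤ c'' π̂_p(n) × d/dp h_p(n)`
   (arm separation, quasi-multiplicativity and the a priori bound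
   `π̂_p(i) ≤ c π̂_p(n) (n/i)^{2-β}`; Kesten's near-critical theory);
3. "If we integrate this relation from `p = 1/2` to `p'` for `n = L(p₀)` … we get" Lemma 6.3.

This file PROVES moves 1 and 3 for the tree's four-arm event
`armEvent ![open, closed, open, closed] r₀ N` (`fourArmProbAt`, `fourArmPivotalSum` of
`WernerPivotalEstimates.lean`), leaving exactly move 2 — stated here only as an explicit
HYPOTHESIS, in the pivotal form `Σ_x P_t(x pivotal for Π̂_N) ≤ C · N² π̂_t(N) · π̂_t(N)` parallel to
the one-arm fact `Werner2009_oneArm_logDeriv` (Werner's intermediate bound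
`c' Σ_x π̂_p(‖x‖/2) π̂_p(n)` with his first bullet `Σ_{x ∈ Λ_n} π̂_p(‖x‖/2) ≤ c n² π̂_p(n)`); it is
not recorded as a named fact because Werner's `Π̂_n` imposes the alternating cyclic order of the
four arms, which `armEvent` does not (see the docstring of `fourArmProbAt`), and pivotality is
sensitive to the difference.

## Contents

* `hasDerivAt_fourArmProbAt_abs_le` — **move 1** (Werner's first display) for the tree's event:
  at every `q ∈ (0, 1)`, `s ↦ π̂_s(N)` has a derivative bounded in absolute value by
  `Σ_{v ∈ Λ_N} P_q(v pivotal for Π̂_N)` (`fourArmPivotalSum`), from `site_russo_inequality`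
  (`SiteRussoInequality.lean`) and `determinedBy_armEvent` (`ArmEventsStructure.lean`).
* `real_ratio_le_exp_of_pivotal_bound` — **move 3 in abstract form** (Grönwall along `h`): for
  ANY event `E` determined by a finite set `F` of sites, if
  `Σ_{v ∈ F} P_t(v pivotal for E) ≤ K · (Σ_x P_t(x pivotal for H(N))) · P_t(E)` for
  `t ∈ (1/2, p)`, then `e^{-K} P_{1/2}(E) ≤ P_p(E) ≤ e^{K} P_{1/2}(E)`: by Russo's inequality and
  Russo's formula for `h_t(N)` (`hasDerivAt_triLRCrossingProb_two`), `t ↦ P_t(E) e^{∓K h_t(N)}` is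
  non-increasing / non-decreasing on `[1/2, p]` (`antitoneOn_of_deriv_nonpos`,
  `monotoneOn_of_deriv_nonneg`), and `0 ≤ h ≤ 1`. No positivity of `P_t(E)` and no logarithm is
  needed.
* `Werner2009_lemma63_of_fourArm_pivotal_bound` — **(A) + move 2 ⇒ (B)**: Lemma 6.2 as printed
  (`Werner2009_lemma62P`, lower bound `c N² π̂_t(N) ≤ Σ_x P_t(x pivotal for H(N))`) and the
  four-arm pivotal estimate (hypothesis) give `Werner2009_lemma63`, with constants `e^{∓K}`,
  `K = max C 0 / c`, for `n₁ ≤ N ≤ L(t, ε)` (`charLengthW_antitone` moves the scale restriction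
  along `(1/2, t)`).
* `triTheta_exponent_of_pivotal_bounds` — crit-perc.S16 from `oneArm_exponent`,
  `fourArm_exponent`, Lemma 6.2 (`Werner2009_lemma62P`), the four-arm pivotal estimate
  (hypothesis) and the one-arm differential inequality (`Werner2009_oneArm_logDeriv`), through
  `triTheta_exponent_of_leavesP`.

## References

* W. Werner, *Lectures on two-dimensional critical percolation*, IAS/Park City Math. Ser. 16
  (2009), Lecture 6, §5, "Using differential inequalities for the four arm event" (the displays
  `|d/dp π̂_p(n)| ≤ Σ_x P_p(x pivotal for Π̂_n)`, `… ≤ c'' π̂_p(n) × d/dp h_p(n)`,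
  `|d/dp log π̂_p(n)| ≤ cst d/dp h_p(n)`) and Lemma 6.3 [WernerPCMI2009].
* P. Nolin, Near-critical percolation in two dimensions, *Electron. J. Probab.* 13 (2008), §6.1,
  Thm. 27 (the same integration for all arm events `A_{j,σ}`) [Nolin2008].
* H. Kesten, Scaling relations for 2D-percolation, *Comm. Math. Phys.* 109 (1987) [KestenScalingCMP1987].
* S. Smirnov, W. Werner, *Math. Res. Lett.* 8 (2001), §2, Thm. 1 (i) [SmirnovWernerMRL2001].

Mathlib: `HasDerivAt.mul`, `HasDerivAt.exp`, `antitoneOn_of_deriv_nonpos`,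
`monotoneOn_of_deriv_nonneg`, `Real.exp_le_exp`, `Real.add_one_le_exp`. Tree: `site_russo_inequality`
(`SiteRussoInequality.lean`), `determinedBy_armEvent`, `triAnnulus` (`ArmEventsStructure.lean`,
`ArmEventsProofs.lean`), `hasDerivAt_triLRCrossingProb_two`, `charLengthW_antitone`
(`WernerCorrelationLengthProofs.lean`), `fourArmProbAt`, `fourArmPivotalSum`, `Werner2009_lemma62P`,
`Werner2009_lemma63` (`WernerPivotalEstimates.lean`), `triTheta_exponent_of_leavesP`
(`WernerPivotalEstimatesProofs.lean`).
-/

noncomputable section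

open Filter Topology MeasureTheory Set
open scoped unitInterval

namespace Literature.Probability.Percolation

open LatticeModels

/-! ### Move 1: Russo's inequality for the four-arm event -/

/-- **`|d/dp π̂_p(n)| ≤ Σ_x P_p(x is pivotal for Π̂_n)`** (Werner 2009, Lecture 6, §5, "Using
differential inequalities for the four arm event", first display), for the tree's four-arm event
`Π̂_N = armEvent ![open, closed, open, closed] r₀ N` (`r₀ ≤ N`): at every `q ∈ (0, 1)` the function
`s ↦ π̂_s(N) = fourArmProbAt s r₀ N` has a derivative `D` with `|D| ≤ fourArmPivotalSum q r₀ N`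
(the event is determined by the sites of the annulus `triAnnulus r₀ N ⊆ Λ_N`, and sites off the
annulus are never pivotal). Real parameter clamped by `Set.projIcc`. [cite: WernerPCMI2009, Lecture 6, §5 (first display of "Using differential inequalities for the four arm event")] -/
theorem hasDerivAt_fourArmProbAt_abs_le {r₀ N : ℕ} (hr : r₀ ≤ N) {q : ℝ} (hq : q ∈ Ioo (0 : ℝ) 1) :
    ∃ D : ℝ, HasDerivAt (fun s : ℝ => fourArmProbAt (projIcc (0 : ℝ) 1 zero_le_one s) r₀ N) D q ∧
      |D| ≤ fourArmPivotalSum (projIcc (0 : ℝ) 1 zero_le_one q) r₀ N := by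
  obtain ⟨D, hD, hle⟩ := site_russo_inequality (V := Site 2) (triAnnulus r₀ N)
    (determinedBy_armEvent ![true, false, true, false] hr) hq
  refine ⟨D, hD, hle.trans ?_⟩
  unfold fourArmPivotalSum
  refine Finset.sum_le_sum_of_subset_of_nonneg ?_ fun v _ _ => measureReal_nonneg
  unfold triAnnulus
  exact Finset.filter_subset _ _

/-! ### Move 3: integration along `h_t(N)` (abstract form) -/

/-- **Integration of a differential inequality along `h_t(N)`** (Werner 2009, Lecture 6, §5:
"`|d/dp log π̂_p(n)| ≤ cst d/dp h_p(n)`. If we integrate this relation from `p = 1/2` to `p'` …";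
Nolin 2008, §6.1, proof of Thm. 27), in abstract Grönwall form, for an ARBITRARY event `E`
determined by a finite set `F` of sites of `𝕋`: if `1/2 < p < 1`, `0 ≤ K` and
`Σ_{v ∈ F} P_t(v pivotal for E) ≤ K · (Σ_x P_t(x pivotal for H(N))) · P_t(E)` for every
`t ∈ (1/2, p)` (`paraPivotalSum t N = d/dt h_t(N)` by Russo's formula), then
`P_p(E) ≤ e^K P_{1/2}(E)` and `P_{1/2}(E) ≤ e^K P_p(E)`. Proof: by Russo's inequality
`|d/dt P_t(E)| ≤ K h'_t(N) P_t(E)`, so `P_t(E) e^{-K h_t(N)}` is non-increasing and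
`P_t(E) e^{K h_t(N)}` non-decreasing on `[1/2, p]`, and `0 ≤ h ≤ 1`. [cite: WernerPCMI2009, Lecture 6, §5 (integration before Lemma 6.3)] [cite: Nolin2008, §6.1, Thm. 27 (proof)] -/
theorem real_ratio_le_exp_of_pivotal_bound {E : Set (SiteConfig (Site 2))} (F : Finset (Site 2))
    (hE : DeterminedBy E ↑F) {p : unitInterval} (hp : 1 / 2 < (p : ℝ)) (hp1 : (p : ℝ) < 1)
    {N : ℕ} {K : ℝ} (hK : 0 ≤ K)
    (hpiv : ∀ t : unitInterval, 1 / 2 < (t : ℝ) → t < p →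
      ∑ v ∈ F, (triSitePercolation t).real {ω | IsPivotal E v ω} ≤
        K * paraPivotalSum t N * (triSitePercolation t).real E) :
    (triSitePercolation p).real E ≤ Real.exp K * (triSitePercolation half).real E ∧
      (triSitePercolation half).real E ≤ Real.exp K * (triSitePercolation p).real E := by
  -- the probability and the crossing probability as functions of a real parameter
  set f : ℝ → ℝ := fun r => (sitePercolation (Site 2) (projIcc (0 : ℝ) 1 zero_le_one r)).real E
    with hf
  set h : ℝ → ℝ := fun r =>
    triLRCrossingProb (projIcc (0 : ℝ) 1 zero_le_one r) (2 * N) N with hh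
  have hprojh : projIcc (0 : ℝ) 1 zero_le_one (1 / 2) = half :=
    Subtype.ext (by rw [projIcc_of_mem zero_le_one ⟨by norm_num, by norm_num⟩]; rfl)
  set D : Set ℝ := Icc (1 / 2) (p : ℝ) with hD
  have hIoo : ∀ q ∈ D, q ∈ Ioo (0 : ℝ) 1 := fun q hq => ⟨by linarith [hq.1], hq.2.trans_lt hp1⟩
  have hval : ∀ q ∈ D, ((projIcc (0 : ℝ) 1 zero_le_one q : unitInterval) : ℝ) = q := fun q hq => by
    rw [projIcc_of_mem zero_le_one ⟨(hIoo q hq).1.le, (hIoo q hq).2.le⟩]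
  -- Russo's inequality for `E` and Russo's formula for `h`
  have hfd : ∀ q ∈ D, HasDerivAt f (deriv f q) q ∧ |deriv f q| ≤
      ∑ v ∈ F, (sitePercolation (Site 2) (projIcc (0 : ℝ) 1 zero_le_one q)).real
        {ω | IsPivotal E v ω} := fun q hq => by
    obtain ⟨D', hD', hle⟩ := site_russo_inequality F hE (hIoo q hq)
    exact ⟨hD'.differentiableAt.hasDerivAt, by rwa [hD'.deriv]⟩
  have hhd : ∀ q ∈ D, HasDerivAt h (paraPivotalSum (projIcc (0 : ℝ) 1 zero_le_one q) N) q :=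
    fun q hq => hasDerivAt_triLRCrossingProb_two N (hIoo q hq)
  -- the key bound on the interior: `|f'| ≤ K h' f`
  have hkey : ∀ q ∈ interior D,
      |deriv f q| ≤ K * paraPivotalSum (projIcc (0 : ℝ) 1 zero_le_one q) N * f q := by
    intro q hq
    have hqD : q ∈ D := interior_subset hq
    rw [hD, interior_Icc] at hq
    set t : unitInterval := projIcc (0 : ℝ) 1 zero_le_one q with ht
    have htq : (t : ℝ) = q := hval q hqD
    have ht1 : 1 / 2 < (t : ℝ) := by rw [htq]; exact hq.1
    have ht2 : t < p := Subtype.coe_lt_coe.1 (by rw [htq]; exact hq.2)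
    exact (hfd q hqD).2.trans (hpiv t ht1 ht2)
  have hf0 : ∀ q, 0 ≤ f q := fun q => measureReal_nonneg
  have hh01 : ∀ q, 0 ≤ h q ∧ h q ≤ 1 := fun q => ⟨measureReal_nonneg, measureReal_le_one⟩
  have hpD : (p : ℝ) ∈ D := ⟨hp.le, le_rfl⟩
  have hhD : (1 / 2 : ℝ) ∈ D := ⟨le_rfl, hp.le⟩
  have hfp : f p = (triSitePercolation p).real E := by
    simp only [hf, projIcc_val zero_le_one p]; rfl
  have hfh : f (1 / 2) = (triSitePercolation half).real E := by simp only [hf, hprojh]; rfl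
  have hexp1 : Real.exp (K * (h p - h (1 / 2))) ≤ Real.exp K := by
    rw [Real.exp_le_exp]
    nlinarith [(hh01 p).2, (hh01 (1 / 2)).1, hK]
  constructor
  · -- `Ψ₁ = f · e^{-K h}` is non-increasing
    set Ψ : ℝ → ℝ := fun r => f r * Real.exp (-K * h r) with hΨ
    have hderiv : ∀ q ∈ D, HasDerivAt Ψ (deriv f q * Real.exp (-K * h q) +
        f q * (Real.exp (-K * h q) *
          (-K * paraPivotalSum (projIcc (0 : ℝ) 1 zero_le_one q) N))) q := fun q hq =>
      (hfd q hq).1.mul (((hhd q hq).const_mul (-K)).exp)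
    have hcont : ContinuousOn Ψ D := fun q hq => (hderiv q hq).continuousAt.continuousWithinAt
    have hdiff : DifferentiableOn ℝ Ψ (interior D) := fun q hq =>
      (hderiv q (interior_subset hq)).differentiableAt.differentiableWithinAt
    have hnonpos : ∀ q ∈ interior D, deriv Ψ q ≤ 0 := by
      intro q hq
      have hb := hkey q hq
      rw [(hderiv q (interior_subset hq)).deriv]
      have he : 0 < Real.exp (-K * h q) := Real.exp_pos _
      have h1 : deriv f q ≤ K * paraPivotalSum (projIcc (0 : ℝ) 1 zero_le_one q) N * f q :=
        (le_abs_self _).trans hb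
      nlinarith [h1, he]
    have hanti : AntitoneOn Ψ D := antitoneOn_of_deriv_nonpos (convex_Icc _ _) hcont hdiff hnonpos
    have hle : Ψ p ≤ Ψ (1 / 2) := hanti hhD hpD hp.le
    have hle' : f p * Real.exp (-K * h p) ≤ f (1 / 2) * Real.exp (-K * h (1 / 2)) := hle
    rw [← hfp, ← hfh]
    have he1 : 0 < Real.exp (-K * h p) := Real.exp_pos _
    calc f p = f p * Real.exp (-K * h p) * Real.exp (K * h p) := by
            rw [mul_assoc, ← Real.exp_add]; ring_nf; rw [Real.exp_zero, mul_one]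
      _ ≤ f (1 / 2) * Real.exp (-K * h (1 / 2)) * Real.exp (K * h p) :=
            mul_le_mul_of_nonneg_right hle' (Real.exp_pos _).le
      _ = Real.exp (K * (h p - h (1 / 2))) * f (1 / 2) := by
            rw [mul_comm (f (1 / 2)), mul_assoc, mul_comm (f (1 / 2)), ← mul_assoc,
              ← Real.exp_add]; ring_nf
      _ ≤ Real.exp K * f (1 / 2) := mul_le_mul_of_nonneg_right hexp1 (hf0 _)
  · -- `Ψ₂ = f · e^{K h}` is non-decreasing
    set Ψ : ℝ → ℝ := fun r => f r * Real.exp (K * h r) with hΨ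
    have hderiv : ∀ q ∈ D, HasDerivAt Ψ (deriv f q * Real.exp (K * h q) +
        f q * (Real.exp (K * h q) *
          (K * paraPivotalSum (projIcc (0 : ℝ) 1 zero_le_one q) N))) q := fun q hq =>
      (hfd q hq).1.mul (((hhd q hq).const_mul K).exp)
    have hcont : ContinuousOn Ψ D := fun q hq => (hderiv q hq).continuousAt.continuousWithinAt
    have hdiff : DifferentiableOn ℝ Ψ (interior D) := fun q hq =>
      (hderiv q (interior_subset hq)).differentiableAt.differentiableWithinAt
    have hnonneg : ∀ q ∈ interior D, 0 ≤ deriv Ψ q := by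
      intro q hq
      have hb := hkey q hq
      rw [(hderiv q (interior_subset hq)).deriv]
      have he : 0 < Real.exp (K * h q) := Real.exp_pos _
      have h1 : -(K * paraPivotalSum (projIcc (0 : ℝ) 1 zero_le_one q) N * f q) ≤ deriv f q :=
        (neg_le_neg hb).trans (neg_abs_le _)
      nlinarith [h1, he]
    have hmono : MonotoneOn Ψ D := monotoneOn_of_deriv_nonneg (convex_Icc _ _) hcont hdiff hnonneg
    have hle : Ψ (1 / 2) ≤ Ψ p := hmono hhD hpD hp.le
    have hle' : f (1 / 2) * Real.exp (K * h (1 / 2)) ≤ f p * Real.exp (K * h p) := hle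
    rw [← hfp, ← hfh]
    calc f (1 / 2) = f (1 / 2) * Real.exp (K * h (1 / 2)) * Real.exp (-K * h (1 / 2)) := by
            rw [mul_assoc, ← Real.exp_add]; ring_nf; rw [Real.exp_zero, mul_one]
      _ ≤ f p * Real.exp (K * h p) * Real.exp (-K * h (1 / 2)) :=
            mul_le_mul_of_nonneg_right hle' (Real.exp_pos _).le
      _ = Real.exp (K * (h p - h (1 / 2))) * f p := by
            rw [mul_comm (f p), mul_assoc, mul_comm (f p), ← mul_assoc, ← Real.exp_add]; ring_nf
      _ ≤ Real.exp K * f p := mul_le_mul_of_nonneg_right hexp1 (hf0 _)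

/-! ### (A) + the four-arm pivotal estimate ⇒ (B) -/

/-- **Lemma 6.3 from Lemma 6.2 and the four-arm pivotal estimate** (Werner 2009, Lecture 6, §5:
"`|d/dp π̂_p(n)| ≤ … ≤ c'' π̂_p(n) × d/dp h_p(n)` and `|d/dp log π̂_p(n)| ≤ cst d/dp h_p(n)`. If we
integrate this relation from `p = 1/2` to `p'` … we get" Lemma 6.3; Nolin 2008, Thm. 27). The
hypothesis `h4` is the four-arm analogue of `Werner2009_oneArm_logDeriv`:
`Σ_{x ∈ Λ_N} P_t(x pivotal for Π̂_N) ≤ C · N² π̂_t(N) · π̂_t(N)` for `1/2 ≤ t < 1/2 + δ` and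
`n₁ ≤ N ≤ L(t, ε)` (Werner's bound `c' Σ_x π̂_p(‖x‖/2) π̂_p(n)` with `Σ_x π̂_p(‖x‖/2) ≤ c n² π̂_p(n)`,
for the tree's event `armEvent ![open, closed, open, closed] r₀ N`). With the lower bound of
Lemma 6.2 as printed (`Werner2009_lemma62P`: `c N² π̂_t(N) ≤ d/dt h_t(N)`), Russo's inequality
(`hasDerivAt_fourArmProbAt_abs_le`) and the integration `real_ratio_le_exp_of_pivotal_bound` give
`e^{-K} π̂_{1/2}(N) ≤ π̂_t(N) ≤ e^{K} π̂_{1/2}(N)`, `K = max C 0 / c`, i.e. `Werner2009_lemma63`. [cite: WernerPCMI2009, Lecture 6, §5 (derivation of Lemma 6.3)] [cite: Nolin2008, §6.1, Thm. 27 (j = 4)] -/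
theorem Werner2009_lemma63_of_fourArm_pivotal_bound (hA : Werner2009_lemma62P)
    (h4 : ∃ ε₁ > (0 : ℝ), ∀ ⦃ε : ℝ⦄, 0 < ε → ε < ε₁ →
      ∃ r₁ : ℕ, ∀ r₀ ≥ r₁, ∃ n₁ : ℕ, ∃ δ > (0 : ℝ), ∃ C : ℝ,
        ∀ t : unitInterval, 1 / 2 ≤ (t : ℝ) → (t : ℝ) < 1 / 2 + δ →
          ∀ N : ℕ, n₁ ≤ N → (1 / 2 < (t : ℝ) → N ≤ charLengthW ε t) →
            fourArmPivotalSum t r₀ N ≤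
              C * ((N : ℝ) ^ 2 * fourArmProbAt t r₀ N) * fourArmProbAt t r₀ N) :
    Werner2009_lemma63 := by
  obtain ⟨εA, hεA, hA⟩ := hA
  obtain ⟨ε4, hε4, h4⟩ := h4
  refine ⟨min εA ε4, lt_min hεA hε4, fun ε hε hεlt => ?_⟩
  obtain ⟨rA, hrA⟩ := hA hε (hεlt.trans_le (min_le_left _ _))
  obtain ⟨r4, hr4⟩ := h4 hε (hεlt.trans_le (min_le_right _ _))
  refine ⟨max rA r4, fun r₀ hr₀ => ?_⟩
  obtain ⟨nA, δA, hδA, cA, hcA, CA, hbA⟩ := hrA r₀ ((le_max_left _ _).trans hr₀)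
  obtain ⟨n4, δ4, hδ4, C4, hb4⟩ := hr4 r₀ ((le_max_right _ _).trans hr₀)
  set K : ℝ := max C4 0 / cA with hKdef
  have hK : 0 ≤ K := div_nonneg (le_max_right _ _) hcA.le
  refine ⟨max (max nA n4) r₀, min (min δA δ4) (1 / 4), lt_min (lt_min hδA hδ4) (by norm_num),
    Real.exp (-K), Real.exp_pos _, Real.exp K, fun t ht1 ht2 N hN hNL => ?_⟩
  have hδ₁ : min (min δA δ4) (1 / 4) ≤ δA := (min_le_left _ _).trans (min_le_left _ _)
  have hδ₂ : min (min δA δ4) (1 / 4) ≤ δ4 := (min_le_left _ _).trans (min_le_right _ _)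
  have hδ₃ : min (min δA δ4) (1 / 4) ≤ 1 / 4 := min_le_right _ _
  have hNA : nA ≤ N := ((le_max_left _ _).trans (le_max_left _ _)).trans hN
  have hN4 : n4 ≤ N := ((le_max_right _ _).trans (le_max_left _ _)).trans hN
  have hNr : r₀ ≤ N := (le_max_right _ _).trans hN
  have hπ0 : 0 ≤ critFourArmProb r₀ N := measureReal_nonneg
  have heK1 : Real.exp (-K) ≤ 1 := by rw [Real.exp_le_one_iff]; linarith
  have h1eK : 1 ≤ Real.exp K := Real.one_le_exp hK
  rcases ht1.eq_or_lt with heq | hlt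
  · -- `t = 1/2`: nothing to prove
    have ht : t = half := Subtype.ext (by rw [coe_half]; exact heq.symm)
    subst ht
    rw [fourArmProbAt_half]
    exact ⟨mul_le_of_le_one_left hπ0 heK1, le_mul_of_one_le_left hπ0 h1eK⟩
  · -- `t > 1/2`: integrate on `[1/2, t]`
    have ht1' : (t : ℝ) < 1 := by linarith
    have hNLt : N ≤ charLengthW ε t := hNL hlt
    have hb := real_ratio_le_exp_of_pivotal_bound (E := armEvent ![true, false, true, false] r₀ N)
      (triAnnulus r₀ N) (determinedBy_armEvent _ hNr) hlt ht1' (N := N) hK fun s hs1 hst => by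
      have hst' : (s : ℝ) < t := Subtype.coe_lt_coe.2 hst
      have hsA : (s : ℝ) < 1 / 2 + δA := by linarith
      have hs4 : (s : ℝ) < 1 / 2 + δ4 := by linarith
      have hNs : N ≤ charLengthW ε s := hNLt.trans (charLengthW_antitone hε hs1 hst.le)
      have hA1 := (hbA s hs1.le hsA N hNA fun _ => hNs).1
      have h41 := hb4 s hs1.le hs4 N hN4 fun _ => hNs
      have hX : (N : ℝ) ^ 2 * fourArmProbAt s r₀ N ≤ paraPivotalSum s N / cA := by
        rw [le_div_iff₀ hcA, mul_comm]; exact hA1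
      have hP0 : 0 ≤ fourArmProbAt s r₀ N := fourArmProbAt_nonneg _ _ _
      -- pivotal sites off the annulus do not contribute
      have hsub : ∑ v ∈ triAnnulus r₀ N, (triSitePercolation s).real
            {ω | IsPivotal (armEvent ![true, false, true, false] r₀ N) v ω} ≤
          fourArmPivotalSum s r₀ N := by
        unfold fourArmPivotalSum
        refine Finset.sum_le_sum_of_subset_of_nonneg ?_ fun v _ _ => measureReal_nonneg
        unfold triAnnulus
        exact Finset.filter_subset _ _
      calc ∑ v ∈ triAnnulus r₀ N, (triSitePercolation s).real
              {ω | IsPivotal (armEvent ![true, false, true, false] r₀ N) v ω}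
          ≤ fourArmPivotalSum s r₀ N := hsub
        _ ≤ C4 * ((N : ℝ) ^ 2 * fourArmProbAt s r₀ N) * fourArmProbAt s r₀ N := h41
        _ ≤ max C4 0 * ((N : ℝ) ^ 2 * fourArmProbAt s r₀ N) * fourArmProbAt s r₀ N :=
            mul_le_mul_of_nonneg_right
              (mul_le_mul_of_nonneg_right (le_max_left _ _) (mul_nonneg (sq_nonneg _) hP0)) hP0
        _ ≤ max C4 0 * (paraPivotalSum s N / cA) * fourArmProbAt s r₀ N := by gcongr
        _ = K * paraPivotalSum s N * (triSitePercolation s).real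
              (armEvent ![true, false, true, false] r₀ N) := by
            rw [hKdef]; unfold fourArmProbAt; ring
    have hb1 : fourArmProbAt t r₀ N ≤ Real.exp K * critFourArmProb r₀ N := hb.1
    have hb2 : critFourArmProb r₀ N ≤ Real.exp K * fourArmProbAt t r₀ N := hb.2
    refine ⟨?_, hb1⟩
    rw [Real.exp_neg, inv_mul_le_iff₀ (Real.exp_pos K)]
    exact hb2

/-! ### The assembly with the four-arm pivotal estimate in place of Lemma 6.3 -/

/-- **crit-perc.S16 from the arm exponents, Lemma 6.2 and the two pivotal estimates**
(Smirnov–Werner 2001, §2, Thm. 1 (i); Werner 2009, Lecture 6, Thm. 6.1): `θ(p) = (p - 1/2)^{5/36 + o(1)}`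
as `p ↓ 1/2` follows from `oneArm_exponent`, `fourArm_exponent`, Lemma 6.2 as printed
(`Werner2009_lemma62P`), the four-arm pivotal estimate (hypothesis `h4`, Werner §5, second
display of "Using differential inequalities for the four arm event") and the one-arm
differential inequality (`Werner2009_oneArm_logDeriv`) — through
`Werner2009_lemma63_of_fourArm_pivotal_bound` and `triTheta_exponent_of_leavesP`. [cite: SmirnovWernerMRL2001, §2, Thm. 1 (i) and the paragraph following it] [cite: WernerPCMI2009, Lecture 6, Thm. 6.1 and §5] -/
theorem triTheta_exponent_of_pivotal_bounds (h₁ : oneArm_exponent) (h₄ : fourArm_exponent)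
    (hA : Werner2009_lemma62P)
    (h4 : ∃ ε₁ > (0 : ℝ), ∀ ⦃ε : ℝ⦄, 0 < ε → ε < ε₁ →
      ∃ r₁ : ℕ, ∀ r₀ ≥ r₁, ∃ n₁ : ℕ, ∃ δ > (0 : ℝ), ∃ C : ℝ,
        ∀ t : unitInterval, 1 / 2 ≤ (t : ℝ) → (t : ℝ) < 1 / 2 + δ →
          ∀ N : ℕ, n₁ ≤ N → (1 / 2 < (t : ℝ) → N ≤ charLengthW ε t) →
            fourArmPivotalSum t r₀ N ≤
              C * ((N : ℝ) ^ 2 * fourArmProbAt t r₀ N) * fourArmProbAt t r₀ N)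
    (hC : Werner2009_oneArm_logDeriv) : triTheta_exponent :=
  triTheta_exponent_of_leavesP h₁ h₄ hA (Werner2009_lemma63_of_fourArm_pivotal_bound hA h4) hC

end Literature.Probability.Percolation
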